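import Mathlib
import HarnessLib
import Summits.Ventures.LatticeQCDFlow.Exactness.CPNLeapfrogHMCErgodic
import Summits.Ventures.LatticeQCDFlow.Exactness.JitteredHMCReversible
import Summits.Ventures.LatticeQCDFlow.Exactness.SUNOmfJitteredHMC
import Summits.Ventures.LatticeQCDFlow.Exactness.UniformJitterLaw

/-!
# The `cpn_2d` HMC with a jittered trajectory length (the `hmc.py` `tau_jitter` recipe transplanted): the labelled geodesic leapfrog on a sphere family is jointly measurable in the step; the jittered kernel for ANY law of the length is EXACT and in DETAILED BALANCE — in particular for the code's uniform law

HONEST FRAMING: exact (Metropolis-corrected) sampling algorithms for lattice gauge theory;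
figures of merit are autocorrelation/cost numbers at stated couplings and volumes; no
continuum-physics claim.

Venture `LatticeQCDFlow` (cell pub-lqcd), topic `Exactness`, FANOUT row 9 (eng-latcore, GEN-25).  ENGINE READING (honest):
in latflow.core 0.2.6 the `tau_jitter` option exists ONLY in `hmc.HMC.trajectory` (4D SU(N) `GaugeField`, 0.2.1+) and in
`phi4_2d.hmc`; `cpn_2d.HMCCPN.trajectory(rng, tau, nstep)` has NO such option.  This file types the cpn_2d HMC kernel of
gen-16 (`SphereFamilyLeapfrog{,HMC}.lean`: a finite family of spheres, ambient Gaussian momenta, exact geodesic drift) WITH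
THE TRAJECTORY LENGTH DRAWN FROM A LAW `η` BEFORE AND INDEPENDENTLY OF THE STATE — the `hmc.py` recipe
`tau_t = tau * (1 + tau_jitter * (2u − 1))` transplanted to cpn_2d (a one-line engine change if ever wanted; NOT an engine
path today).  NEW WORK of the cell over gen-16's
`famProposal` (involution, Liouville), GEN-22's `jitterHMC` / `jitterHMC_exact` (`JitteredHMC.lean`) and
`jitterHMC_isReversible` (`JitteredHMCReversible.lean`), GEN-24's `measurable_uncurry_labelledPow` (`SUNOmfJitteredHMC.lean`)
and `uniformJitterLaw` (the code's law).  GEN-20/24 recorded `tau_jitter` for cpn_2d as NOT typed; this file types its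
EXACTNESS (convergence of the jittered cpn_2d chain waits for the multi-step chain 20-5 … 20-11).  Nothing is cited as a
fact; no number is claimed.

## Content

* §1 JOINT MEASURABILITY IN THE LABEL: `measurable_uncurry_geodesicDrift` (the E–S drift formula in `(t, z)`),
  `measurable_uncurry_ambientDrift`, `measurable_uncurry_famDrift`, `measurable_uncurry_famKick`,
  `measurable_uncurry_famLeapfrogPerm`, **`measurable_uncurry_famProposal`** (`(l, z) ↦ Ψ^{N_l}_{δ_l}(z)` for measurable
  `δ`, `N`), `measurable_jitterMap_famProposal`.
* §2 **`famJitterHMCL F hF hδ hN S η`** (def) — the jittered geodesic leapfrog HMC on a sphere family for ANY measurable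
  label space and law: refresh Gaussian ambient momenta and an independent label `l ∼ η`, run `N_l` steps of size `δ_l`,
  flip, Metropolis test on `S + Σ‖pᵢ‖²/2`, forget; Markov; **`famJitterHMCL_invariant`** (`e^{−S}·⊗σ`),
  **`famJitterHMCL_invariant_gibbsLaw`** (`famGibbsLaw S`), **`famJitterHMCL_isReversible`** — for EVERY law `η`.
* §3 THE `cpn_2d` KERNEL WITH A JITTERED LENGTH: **`cpnLengthJitterHMC`** (def: label = the drawn length `τ'`, step
  `τ'/nstep`, `nstep` steps, action `cpnAction`); **`cpn_lengthJitterHMC_invariant`** / **`_isReversible`** w.r.t. `cpnGibbsLaw`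
  for EVERY law of the length and every `nstep`; **`cpn_uniformJitterHMC_invariant`** / **`_isReversible`** — with the code's
  law `uniformJitterLaw τ j` of `hmc.py`, every `(nstep, τ, j)`.

NOT CLAIMED: that latflow.core 0.2.6 runs cpn_2d with `tau_jitter` (it does not — see the engine reading above);
convergence / certificates of the jittered cpn_2d chain (needs the multi-step position law, chain 20-5 … 20-11, then the
GEN-24 interval route); any constant; floating point.
-/

noncomputable section

namespace Summit.Ventures.LatticeQCDFlow.Exactness

open MeasureTheory ProbabilityTheory ProbabilityTheory.Kernel Set Function Metric
open scoped ENNReal NNReal InnerProductSpace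

set_option backward.isDefEq.respectTransparency false

/-! ## §1 Joint measurability of the labelled family leapfrog -/

section Measurable

variable {m : Type*} [Fintype m]

/-- The E–S geodesic drift formula is jointly measurable in `(t, z)`. -/
theorem measurable_uncurry_geodesicDrift :
    Measurable fun q : ℝ × ((EuclideanSpace ℝ m) × (EuclideanSpace ℝ m)) => geodesicDrift q.1 q.2 := by
  have ht : Measurable fun q : ℝ × ((EuclideanSpace ℝ m) × (EuclideanSpace ℝ m)) => q.1 := measurable_fst
  have hn : Measurable fun q : ℝ × ((EuclideanSpace ℝ m) × (EuclideanSpace ℝ m)) => ‖q.2.2‖ :=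
    measurable_snd.snd.norm
  have hc : Measurable fun q : ℝ × ((EuclideanSpace ℝ m) × (EuclideanSpace ℝ m)) => Real.cos (‖q.2.2‖ * q.1) :=
    Real.measurable_cos.comp (hn.mul ht)
  have hs : Measurable fun q : ℝ × ((EuclideanSpace ℝ m) × (EuclideanSpace ℝ m)) => Real.sin (‖q.2.2‖ * q.1) :=
    Real.measurable_sin.comp (hn.mul ht)
  unfold geodesicDrift
  exact ((hc.smul measurable_snd.fst).add ((hs.div hn).smul measurable_snd.snd)).prodMk
    (((hn.mul hs).neg.smul measurable_snd.fst).add (hc.smul measurable_snd.snd))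

/-- The position of the ambient drift, read in the ambient space (definitional unfolding, stated once so that no
unification has to look inside `ambientDrift`). -/
theorem coe_fst_ambientDrift_def (t : ℝ) (z : (sphere (0 : EuclideanSpace ℝ m) 1) × (EuclideanSpace ℝ m)) :
    ((ambientDrift t z).1 : EuclideanSpace ℝ m) =
      (geodesicDrift t (((z.1 : EuclideanSpace ℝ m)), tangentialPart z)).1 := rfl

/-- The momentum of the ambient drift (definitional unfolding). -/
theorem snd_ambientDrift_def (t : ℝ) (z : (sphere (0 : EuclideanSpace ℝ m) 1) × (EuclideanSpace ℝ m)) :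
    (ambientDrift t z).2 =
      (geodesicDrift t (((z.1 : EuclideanSpace ℝ m)), tangentialPart z)).2 +
        ⟪(z.1 : EuclideanSpace ℝ m), z.2⟫_ℝ • (geodesicDrift t (((z.1 : EuclideanSpace ℝ m)), tangentialPart z)).1 := rfl

/-- The ambient drift is jointly measurable in `(t, z)` (assembled coordinatewise from the two `rfl` readings above,
so that no unification has to unfold `ambientDrift` or `geodesicDrift`). -/
theorem measurable_uncurry_ambientDrift :
    Measurable fun q : ℝ × ((sphere (0 : EuclideanSpace ℝ m) 1) × (EuclideanSpace ℝ m)) => ambientDrift q.1 q.2 := by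
  have hxv : Measurable fun q : ℝ × ((sphere (0 : EuclideanSpace ℝ m) 1) × (EuclideanSpace ℝ m)) =>
      (q.1, (((q.2.1 : EuclideanSpace ℝ m)), tangentialPart q.2)) :=
    measurable_fst.prodMk ((measurable_subtype_coe.comp measurable_snd.fst).prodMk
      (continuous_tangentialPart.measurable.comp measurable_snd))
  have hg : Measurable fun q : ℝ × ((sphere (0 : EuclideanSpace ℝ m) 1) × (EuclideanSpace ℝ m)) =>
      geodesicDrift q.1 (((q.2.1 : EuclideanSpace ℝ m)), tangentialPart q.2) := by
    have h := (measurable_uncurry_geodesicDrift (m := m)).comp hxv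
    simpa only [Function.comp_def] using h
  have hi : Measurable fun q : ℝ × ((sphere (0 : EuclideanSpace ℝ m) 1) × (EuclideanSpace ℝ m)) =>
      ⟪(q.2.1 : EuclideanSpace ℝ m), q.2.2⟫_ℝ :=
    (((continuous_subtype_val.comp continuous_fst).inner continuous_snd).measurable).comp measurable_snd
  have hemb : MeasurableEmbedding ((↑) : (sphere (0 : EuclideanSpace ℝ m) 1) → EuclideanSpace ℝ m) :=
    MeasurableEmbedding.subtype_coe isClosed_sphere.measurableSet
  -- position component, read in the ambient space
  have h1 : Measurable fun q : ℝ × ((sphere (0 : EuclideanSpace ℝ m) 1) × (EuclideanSpace ℝ m)) =>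
      ((ambientDrift q.1 q.2).1 : EuclideanSpace ℝ m) := by
    rw [show (fun q : ℝ × ((sphere (0 : EuclideanSpace ℝ m) 1) × (EuclideanSpace ℝ m)) =>
        ((ambientDrift q.1 q.2).1 : EuclideanSpace ℝ m)) =
        fun q => (geodesicDrift q.1 (((q.2.1 : EuclideanSpace ℝ m)), tangentialPart q.2)).1 from
      funext fun q => coe_fst_ambientDrift_def q.1 q.2]
    have h := measurable_fst.comp hg
    simpa only [Function.comp_def] using h
  -- momentum component
  have h2 : Measurable fun q : ℝ × ((sphere (0 : EuclideanSpace ℝ m) 1) × (EuclideanSpace ℝ m)) =>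
      (ambientDrift q.1 q.2).2 := by
    rw [show (fun q : ℝ × ((sphere (0 : EuclideanSpace ℝ m) 1) × (EuclideanSpace ℝ m)) => (ambientDrift q.1 q.2).2) =
        fun q => (geodesicDrift q.1 (((q.2.1 : EuclideanSpace ℝ m)), tangentialPart q.2)).2 +
          ⟪(q.2.1 : EuclideanSpace ℝ m), q.2.2⟫_ℝ •
            (geodesicDrift q.1 (((q.2.1 : EuclideanSpace ℝ m)), tangentialPart q.2)).1 from
      funext fun q => snd_ambientDrift_def q.1 q.2]
    have ha := measurable_snd.comp hg
    have hb := measurable_fst.comp hg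
    simp only [Function.comp_def] at ha hb
    exact ha.add (hi.smul hb)
  exact measurable_fun_prod.2 ⟨hemb.measurable_comp_iff.1 h1, h2⟩

variable {ι : Type*} [Fintype ι] {k : ι → ℕ} {Lab : Type*} [MeasurableSpace Lab]

omit [Fintype ι] in
/-- The labelled family drift `(l, z) ↦ famDrift (δ l) z` is jointly measurable (measurable `δ`). -/
theorem measurable_uncurry_famDrift {δ : Lab → ℝ} (hδ : Measurable δ) :
    Measurable fun q : Lab × ((Π i, FamS k i) × (Π i, FamE k i)) => famDrift (k := k) (δ q.1) q.2 := by
  have hcomp : ∀ i, Measurable fun q : Lab × ((Π i, FamS k i) × (Π i, FamE k i)) =>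
      ambientDrift (δ q.1) (q.2.1 i, q.2.2 i) := fun i => by
    have hin : Measurable fun q : Lab × ((Π i, FamS k i) × (Π i, FamE k i)) => (δ q.1, (q.2.1 i, q.2.2 i)) :=
      (hδ.comp measurable_fst).prodMk
        (((measurable_pi_apply i).comp measurable_snd.fst).prodMk ((measurable_pi_apply i).comp measurable_snd.snd))
    have h := (measurable_uncurry_ambientDrift (m := Fin (k i + 2))).comp hin
    simpa only [Function.comp_def] using h
  -- read the sitewise drift coordinate by coordinate (`famDrift_fst_apply`, `famDrift_snd_apply` are `rfl` lemmas;
  -- rewriting with them keeps the unifier away from `famSitewise`)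
  have h : (fun q : Lab × ((Π i, FamS k i) × (Π i, FamE k i)) => famDrift (k := k) (δ q.1) q.2) =
      fun q => (fun i => (ambientDrift (δ q.1) (q.2.1 i, q.2.2 i)).1, fun i => (ambientDrift (δ q.1) (q.2.1 i, q.2.2 i)).2) := by
    funext q
    refine Prod.ext (funext fun i => ?_) (funext fun i => ?_)
    · exact famDrift_fst_apply (δ q.1) q.2 i
    · exact famDrift_snd_apply (δ q.1) q.2 i
  rw [h]
  exact (measurable_pi_lambda _ fun i => measurable_fst.comp (hcomp i)).prodMk
    (measurable_pi_lambda _ fun i => measurable_snd.comp (hcomp i))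

/-- The labelled coupled kick `(l, z) ↦ famKick F (c l) z` is jointly measurable (measurable `F`, `c`). -/
theorem measurable_uncurry_famKick {F : (Π i, FamS k i) → (Π i, FamE k i)} (hF : Measurable F) {c : Lab → ℝ}
    (hc : Measurable c) :
    Measurable fun q : Lab × ((Π i, FamS k i) × (Π i, FamE k i)) => famKick F (c q.1) q.2 := by
  haveI : OpensMeasurableSpace (ℝ × (Π i, FamE k i)) := Prod.opensMeasurableSpace
  have hsmul : Measurable fun q : Lab × ((Π i, FamS k i) × (Π i, FamE k i)) => c q.1 • F q.2.1 :=
    continuous_smul.measurable.comp ((hc.comp measurable_fst).prodMk (hF.comp measurable_snd.fst))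
  exact measurable_snd.fst.prodMk (measurable_snd.snd.add hsmul)

/-- One labelled family leapfrog step `(l, z) ↦ (K_{δ_l/2} D_{δ_l} K_{δ_l/2})(z)` is jointly measurable. -/
theorem measurable_uncurry_famLeapfrogPerm {F : (Π i, FamS k i) → (Π i, FamE k i)} (hF : Measurable F)
    {δ : Lab → ℝ} (hδ : Measurable δ) :
    Measurable fun q : Lab × ((Π i, FamS k i) × (Π i, FamE k i)) => famLeapfrogPerm F (δ q.1) q.2 := by
  have hK := measurable_uncurry_famKick (k := k) hF (hδ.div_const 2)
  have hD := measurable_uncurry_famDrift (k := k) (Lab := Lab) hδ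
  have h : (fun q : Lab × ((Π i, FamS k i) × (Π i, FamE k i)) => famLeapfrogPerm F (δ q.1) q.2) =
      fun q => famKick F (δ q.1 / 2) (famDrift (δ q.1) (famKick F (δ q.1 / 2) q.2)) := by
    funext q; rw [famLeapfrogPerm, Equiv.Perm.coe_mul, Equiv.Perm.coe_mul]; rfl
  rw [h]
  exact hK.comp (measurable_fst.prodMk (hD.comp (measurable_fst.prodMk hK)))

/-- **THE LABELLED FAMILY PROPOSAL `(l, z) ↦ Ψ^{N_l}_{δ_l}(z)` IS JOINTLY MEASURABLE** (measurable `F`, `δ`, `N`). -/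
theorem measurable_uncurry_famProposal {F : (Π i, FamS k i) → (Π i, FamE k i)} (hF : Measurable F)
    {δ : Lab → ℝ} (hδ : Measurable δ) {N : Lab → ℕ} (hN : Measurable N) :
    Measurable fun q : Lab × ((Π i, FamS k i) × (Π i, FamE k i)) => famProposal F (δ q.1) (N q.1) q.2 := by
  have hW := measurable_uncurry_famLeapfrogPerm (k := k) hF hδ
  have hP := measurable_uncurry_labelledPow (Lab := Lab) (f := fun l => ⇑(famLeapfrogPerm F (δ l))) hW hN
  have hflip : Measurable (famFlip (k := k)) := measurable_fst.prodMk measurable_snd.neg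
  have h : (fun q : Lab × ((Π i, FamS k i) × (Π i, FamE k i)) => famProposal F (δ q.1) (N q.1) q.2) =
      fun q => famFlip ((⇑(famLeapfrogPerm F (δ q.1)))^[N q.1] q.2) := by
    funext q; rw [famProposal, Equiv.Perm.coe_mul, Equiv.Perm.coe_pow]; rfl
  rw [h]
  exact hflip.comp hP

/-- Hence the jittered family proposal on the enlarged phase space is measurable. -/
theorem measurable_jitterMap_famProposal {F : (Π i, FamS k i) → (Π i, FamE k i)} (hF : Measurable F)
    {δ : Lab → ℝ} (hδ : Measurable δ) {N : Lab → ℕ} (hN : Measurable N) :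
    Measurable (jitterMap fun l => ⇑(famProposal F (δ l) (N l))) :=
  measurable_jitterMap (measurable_uncurry_famProposal hF hδ hN)

end Measurable

/-! ## §2 The jittered family kernel for an arbitrary label law: exact and reversible for every law -/

section Kernel

variable {ι : Type*} [Fintype ι] {k : ι → ℕ} {Lab : Type*} [MeasurableSpace Lab]
variable (F : (Π i, FamS k i) → (Π i, FamE k i)) (hF : Measurable F) {δ : Lab → ℝ} (hδ : Measurable δ)
  {N : Lab → ℕ} (hN : Measurable N) (S : (Π i, FamS k i) → ℝ) (η : Measure Lab)

/-- **THE JITTERED GEODESIC LEAPFROG HMC ON A SPHERE FAMILY, ANY LABEL LAW**: refresh `p ∼ famMomentumLaw` and an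
independent label `l ∼ η`, run `N_l` family leapfrog steps of size `δ_l` with the coupled force `F`, flip, Metropolis
test on `S + Σ‖pᵢ‖²/2`, forget `(p, l)`. -/
def famJitterHMCL : Kernel (Π i, FamS k i) (Π i, FamS k i) :=
  jitterHMC (fun l => ⇑(famProposal F (δ l) (N l))) (measurable_jitterMap_famProposal hF hδ hN) S
    (famKinetic (k := k)) η (famMomentumLaw k)

variable {F hF hδ hN S η}

/-- The kernel is Markov for every probability law `η` (measurable `S`). -/
theorem isMarkovKernel_famJitterHMCL [IsProbabilityMeasure η] (hS : Measurable S) :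
    IsMarkovKernel (famJitterHMCL F hF hδ hN S η) := by
  unfold famJitterHMCL
  exact isMarkovKernel_jitterHMC _ _ η _ hS measurable_famKinetic

/-- **EXACT FOR EVERY LAW OF THE LABEL**: the kernel leaves `e^{−S}·⊗ uniformSphere` invariant for every probability
law `η`, every measurable `S`, force, step and step-count assignment. -/
theorem famJitterHMCL_invariant [IsProbabilityMeasure η] (hS : Measurable S) :
    Invariant (famJitterHMCL F hF hδ hN S η)
      ((Measure.pi fun i => uniformSphere (volume : Measure (FamE k i))).withDensity
        fun x => ENNReal.ofReal (Real.exp (-S x))) :=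
  jitterHMC_exact (vol := Measure.pi fun i => uniformSphere (volume : Measure (FamE k i)))
    (volP := Measure.pi fun i => (volume : Measure (FamE k i))) η hS measurable_famKinetic
    (fun l => involutive_famProposal F (δ l) (N l)) (fun l => measurePreserving_famProposal hF (δ l) (N l))
    famMomentumWeight_univ_ne_zero_ne_top.1 famMomentumWeight_univ_ne_zero_ne_top.2

/-- It leaves the normalised Gibbs law `famGibbsLaw S` invariant. -/
theorem famJitterHMCL_invariant_gibbsLaw [IsProbabilityMeasure η] (hS : Measurable S) :
    Invariant (famJitterHMCL F hF hδ hN S η) (famGibbsLaw S) :=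
  invariant_smul (famJitterHMCL_invariant hS) _

/-- **DETAILED BALANCE FOR EVERY LAW OF THE LABEL** w.r.t. `e^{−S}·⊗ uniformSphere`. -/
theorem famJitterHMCL_isReversible [IsProbabilityMeasure η] (hS : Measurable S) :
    IsReversible (famJitterHMCL F hF hδ hN S η)
      ((Measure.pi fun i => uniformSphere (volume : Measure (FamE k i))).withDensity
        fun x => ENNReal.ofReal (Real.exp (-S x))) :=
  jitterHMC_isReversible (vol := Measure.pi fun i => uniformSphere (volume : Measure (FamE k i)))
    (volP := Measure.pi fun i => (volume : Measure (FamE k i))) η hS measurable_famKinetic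
    (fun l => involutive_famProposal F (δ l) (N l)) (fun l => measurePreserving_famProposal hF (δ l) (N l))

/-- Detailed balance w.r.t. the normalised Gibbs law. -/
theorem famJitterHMCL_isReversible_gibbsLaw [IsProbabilityMeasure η] (hS : Measurable S) :
    IsReversible (famJitterHMCL F hF hδ hN S η) (famGibbsLaw S) :=
  isReversible_smul (famJitterHMCL_isReversible hS) _

end Kernel

/-! ## §3 The `cpn_2d` engine with `tau_jitter`: exact and reversible for every law of the length -/

section CPN

variable {V E : Type*} [Fintype V] [Fintype E] {d : ℕ}
  (src tgt : E → V) (J : EuclideanSpace ℝ (Fin (d + 2)) →L[ℝ] EuclideanSpace ℝ (Fin (d + 2))) (c : E → ℝ)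
  (F : CPNConfig V E d → (Π i, FamE (cpnDim V E d) i)) (hF : Measurable F) (nstep : ℕ) (η : Measure ℝ)

/-- **THE `cpn_2d` HMC KERNEL WITH THE TRAJECTORY LENGTH DRAWN FROM A GENERAL LAW `η`** (the `hmc.py` `tau_jitter` recipe
transplanted to gen-16's cpn_2d kernel; not an option of `HMCCPN.trajectory` in latflow.core 0.2.6): label = the drawn
length `τ'`, `nstep` geodesic leapfrog steps of size `τ'/nstep`, action `cpnAction`. -/
def cpnLengthJitterHMC : Kernel (CPNConfig V E d) (CPNConfig V E d) :=
  famJitterHMCL (k := cpnDim V E d) F hF (δ := fun τ' : ℝ => τ' / nstep) (measurable_id.div_const _)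
    (N := fun _ => nstep) measurable_const (cpnAction src tgt J c) η

variable {src tgt J c F hF nstep η}

/-- The engine kernel is Markov for every probability law of the length. -/
theorem isMarkovKernel_cpnLengthJitterHMC [IsProbabilityMeasure η] :
    IsMarkovKernel (cpnLengthJitterHMC src tgt J c F hF nstep η) :=
  isMarkovKernel_famJitterHMCL (continuous_cpnAction src tgt J c).measurable

/-- **EXACT FOR EVERY LAW OF THE TRAJECTORY LENGTH AND EVERY `nstep`**: the jittered cpn_2d HMC leaves the lattice
CP(N−1) law `cpnGibbsLaw` invariant. -/
theorem cpn_lengthJitterHMC_invariant [IsProbabilityMeasure η] :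
    Invariant (cpnLengthJitterHMC src tgt J c F hF nstep η) (cpnGibbsLaw src tgt J c) := by
  rw [← famGibbsLaw_cpnAction]
  exact famJitterHMCL_invariant_gibbsLaw (continuous_cpnAction src tgt J c).measurable

/-- **DETAILED BALANCE FOR EVERY LAW OF THE TRAJECTORY LENGTH** w.r.t. `cpnGibbsLaw`. -/
theorem cpn_lengthJitterHMC_isReversible [IsProbabilityMeasure η] :
    IsReversible (cpnLengthJitterHMC src tgt J c F hF nstep η) (cpnGibbsLaw src tgt J c) := by
  rw [← famGibbsLaw_cpnAction]
  exact famJitterHMCL_isReversible_gibbsLaw (continuous_cpnAction src tgt J c).measurable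

/-- **WITH THE CODE'S LAW** `τ(1 + j(2u − 1))`, `u ∼ U(0,1)` (`hmc.py`): exact for EVERY `nstep`, `τ`, `j`. -/
theorem cpn_uniformJitterHMC_invariant (τ j : ℝ) :
    Invariant (cpnLengthJitterHMC src tgt J c F hF nstep (uniformJitterLaw τ j)) (cpnGibbsLaw src tgt J c) :=
  cpn_lengthJitterHMC_invariant

/-- **WITH THE CODE'S LAW**: detailed balance for every `nstep`, `τ`, `j`. -/
theorem cpn_uniformJitterHMC_isReversible (τ j : ℝ) :
    IsReversible (cpnLengthJitterHMC src tgt J c F hF nstep (uniformJitterLaw τ j)) (cpnGibbsLaw src tgt J c) :=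
  cpn_lengthJitterHMC_isReversible

end CPN

end Summit.Ventures.LatticeQCDFlow.Exactness

end
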